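import Mathlib

/-!
# KL-trained proposals: the χ²–KL floor for importance sampling (DEQ-A202, Prop. A202.1, receipt)

HONEST FRAMING: instance-level adjudication of specific advantage claims; no claim about
BQP vs BPP or the summit.

Lane receipt for unit pub-qadeq-deq-2 (gen 31, DEQ-A202 v1.0). Context (cell pub-qadeq, claim A-202 =
Pyretzidis–Martínez de Lejarza–Rodrigo, "Unlocking Multidimensional Integration with Quantum Adaptive
Importance Sampling", Commun. Phys. (2026) = arXiv:2506.19965v3): a parameterised quantum circuit is
trained to a cell-probability table `P` on a `2^n`-cell grid by minimising `D_KL(P‖Q)` and then used as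
the importance-sampling proposal `Q`; the paper reports residual `D_KL = 0.09–0.27`. For an importance
sampler whose proposal is piecewise constant on the grid, `N · Var(Î/I) ≥ χ²(P‖Q) = Σ_i P_i²/Q_i − 1`
(the cell-level term of the variance), and the elementary inequality proved here,
`Σ_i P_i²/Q_i ≥ exp(Σ_i P_i log(P_i/Q_i)) = e^{D_KL(P‖Q)}`, turns a reported KL into a variance FLOOR
`N · Var ≥ e^{D_KL} − 1` for the trained circuit, whereas the classical histogram sampler with `Q = P`
(the circuit's own training target, sampled by inverse CDF) has `χ² = 0` (DEQ-A202 §4, toy T41).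

What is here (Mathlib-only, no `def`, no named fact, no `sorry`):
* `exp_kl_le_chiSqSucc` : for finitely many cells with `0 < P_i`, `0 < Q_i`, `Σ P_i = 1`:
  `Real.exp (Σ_i P_i * log (P_i / Q_i)) ≤ Σ_i P_i ^ 2 / Q_i` — weighted AM–GM
  (`Real.inner_le_nnorm_mul_nnorm` is not needed; `Real.geom_mean_le_arith_mean_weighted` suffices);
* `kl_le_chiSq` : the weaker textbook form `Σ_i P_i * log (P_i / Q_i) ≤ Σ_i P_i ^ 2 / Q_i − 1`;
* `chiSq_eq_zero_of_eq` : with `Q = P` the cell-level term vanishes: `Σ_i P_i ^ 2 / P_i − 1 = 0`.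

All `[folklore]` (Jensen / AM–GM); the value is the kernel-checked conversion "reported KL ⇒ variance
floor" used in the adjudication.
-/

namespace Summit.QuantumAdvantage.Dequantization.ImportanceSamplingKLFloor

open Finset Real

variable {ι : Type*} [Fintype ι]

/-- Weighted AM–GM in the form needed: `exp (Σ P_i log (P_i/Q_i)) = Π (P_i/Q_i)^{P_i} ≤ Σ P_i · (P_i/Q_i)`. -/
theorem exp_kl_le_chiSqSucc (P Q : ι → ℝ) (hP : ∀ i, 0 < P i) (hQ : ∀ i, 0 < Q i)
    (hsum : ∑ i, P i = 1) :
    Real.exp (∑ i, P i * Real.log (P i / Q i)) ≤ ∑ i, P i ^ 2 / Q i := by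
  have hz : ∀ i, 0 < P i / Q i := fun i => div_pos (hP i) (hQ i)
  -- rewrite the exponential of the sum as a weighted geometric mean
  have h1 : Real.exp (∑ i, P i * Real.log (P i / Q i)) = ∏ i, (P i / Q i) ^ (P i) := by
    rw [Real.exp_sum]
    refine Finset.prod_congr rfl ?_
    intro i _
    rw [Real.rpow_def_of_pos (hz i), mul_comm]
  -- weighted AM–GM with weights P and values P/Q
  have h2 : ∏ i, (P i / Q i) ^ (P i) ≤ ∑ i, P i * (P i / Q i) :=
    Real.geom_mean_le_arith_mean_weighted (Finset.univ) P (fun i => P i / Q i)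
      (fun i _ => (hP i).le) hsum (fun i _ => (hz i).le)
  have h3 : ∑ i, P i * (P i / Q i) = ∑ i, P i ^ 2 / Q i := by
    refine Finset.sum_congr rfl ?_
    intro i _
    rw [sq, mul_div_assoc]
  calc Real.exp (∑ i, P i * Real.log (P i / Q i)) = ∏ i, (P i / Q i) ^ (P i) := h1
    _ ≤ ∑ i, P i * (P i / Q i) := h2
    _ = ∑ i, P i ^ 2 / Q i := h3

/-- The textbook consequence `D_KL(P‖Q) ≤ χ²(P‖Q)` (from `1 + x ≤ e^x`). -/
theorem kl_le_chiSq (P Q : ι → ℝ) (hP : ∀ i, 0 < P i) (hQ : ∀ i, 0 < Q i)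
    (hsum : ∑ i, P i = 1) :
    ∑ i, P i * Real.log (P i / Q i) ≤ ∑ i, P i ^ 2 / Q i - 1 := by
  have h := exp_kl_le_chiSqSucc P Q hP hQ hsum
  have h' := Real.add_one_le_exp (∑ i, P i * Real.log (P i / Q i))
  linarith

/-- With the proposal equal to the target table the cell-level variance term vanishes. -/
theorem chiSq_eq_zero_of_eq (P : ι → ℝ) (hP : ∀ i, 0 < P i) (hsum : ∑ i, P i = 1) :
    ∑ i, P i ^ 2 / P i - 1 = 0 := by
  have : ∑ i, P i ^ 2 / P i = ∑ i, P i := by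
    refine Finset.sum_congr rfl ?_
    intro i _
    rw [sq, mul_div_assoc, div_self (hP i).ne', mul_one]
  rw [this, hsum]; ring

end Summit.QuantumAdvantage.Dequantization.ImportanceSamplingKLFloor
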